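import Summits.Ventures.CertifiedManyBodySolver.Theorems.M3x2EdgeSplitUpperEdgeCellWords
import Summits.Ventures.CertifiedManyBodySolver.Upper.StripCellHamiltonianTTPrime
import HarnessLib

/-!
# Strip-cell certificates, bridge layer L4 with `t' ≠ 0`: the `t–t′` cell Hamiltonian as product words,
# and the tree's bond image of `stripCellBondMatrixTT' κ₀` as the verifier's sweeps

HONEST FRAMING: first certified bounds; not a superconductivity verdict; every number certified or
labelled float. Pure algebra, zero row value; `--supports` infrastructure (bridge lemma group L4,
HOME `hubbard-upper-eng-1/eng-g26/BRIDGE-SPEC.md`) toward crux `UpperEdge_le_m73o100`; closes nothing.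
The `t' ≠ 0` twin of `Theorems/M3x2EdgeSplitUpperEdgeCellWords.lean` for the `t–t′` presentation
`Upper/StripCellHamiltonianTTPrime.lean` (`stripCellBondMatrixTT' κ hc t t' U = superSite κ (toSpin
H_cell(t,t′,U)) ⊗ₖ 1 + interCellMatrix κ hc t + interCellDiagMatrix κ hc t'`; 17 of the 25 certified
strip cells of record have `t′ ≠ 0`):

* `toSpin_hubbardOpenBoxTT'_eq_sum_productOp` — the `t–t′` cell in spin language = the `t' = 0` word
  sum plus `−t′ Σ_{p q σ} [p, q diagonal neighbours] ⨂ jwWordFamily p q c†_σ c_σ`;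
* `opSandwich_cellTensor_toSpin_cellTT'` — its weighted sweep, word by word (`c·W` sweeps each);
* `bondImage_cellTensor_interCellDiagMatrix` — the diagonal inter-cell coupling = double sweeps over
  the adjacent row pairs `adjRowPairs W`;
* **`bondImage_cellTensor_stripCellBondMatrixTT'`** — the assembly: the tree's bond image of the
  `t–t′` strip-cell bond matrix for a site-by-site cell tensor is the verifier's sweep program.

0 `sorry`, 0 `def`.
-/

namespace Summit.Ventures.CertifiedManyBodySolver.Theorems

open Matrix Literature.MathematicalPhysics.QuantumLattice Literature.MathematicalPhysics.QuantumLattice.JordanWigner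
  Summit.Ventures.CertifiedManyBodySolver.Upper
open scoped Kronecker

variable {c W : ℕ}

/-- **The `c × W` open `t–t′` Hubbard cell in spin language is a guarded sum of product words**: the
`t' = 0` words (nearest-neighbour hops, doublons) plus `−t′ ×` the diagonal hopping words. -/
theorem toSpin_hubbardOpenBoxTT'_eq_sum_productOp (t t' U : ℝ) :
    toSpin (hubbardOpenBoxTT' c W t t' U) =
      -(t : ℂ) • (∑ f : Fin c ×ₗ Fin W, ∑ f' : Fin c ×ₗ Fin W, ∑ σ : Fin 2,
          if (rectBoxGraph c W).Adj f f' then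
            productOp (jwWordFamily f f' (siteCreation σ) (siteAnnihilation σ)) else 0) +
      (U : ℂ) • (∑ f : Fin c ×ₗ Fin W,
          productOp (Function.update (fun _ => (1 : Matrix (Fin 4) (Fin 4) ℂ)) f siteDouble)) +
      -(t' : ℂ) • (∑ f : Fin c ×ₗ Fin W, ∑ f' : Fin c ×ₗ Fin W, ∑ σ : Fin 2,
          if (rectBoxDiagGraph c W).Adj f f' then
            productOp (jwWordFamily f f' (siteCreation σ) (siteAnnihilation σ)) else 0) := by
  rw [toSpin_hubbardOpenBoxTT'_eq_add_diag, toSpin_hubbardOpenBoxTT'_zero_eq_sum_productOp]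
  refine congrArg₂ (fun X Y : Op (Fin c ×ₗ Fin W) 4 => X + -(t' : ℂ) • Y) rfl ?_
  refine Finset.sum_congr rfl fun f _ => Finset.sum_congr rfl fun f' _ =>
    Finset.sum_congr rfl fun σ _ => ?_
  by_cases h : (rectBoxDiagGraph c W).Adj f f'
  · rw [if_pos h, if_pos h]
    exact onSite_mul_jwString_mul_jwString_mul_onSite h.ne _ _
  · rw [if_neg h, if_neg h]

/-- **The `t–t′` intra-cell part, swept**: the `superSite κ₀ (toSpin H_cell(t,t′,U))`-weighted sweep of
`M` for the site-by-site cell tensor, word by word (`c·W` one-site sweeps each). -/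
theorem opSandwich_cellTensor_toSpin_cellTT' {β : Type*} [Fintype β] [DecidableEq β]
    (k : Fin (c * W) → Fin 4 → Matrix β β ℂ) (t t' U : ℝ) (M : Matrix β β ℂ) :
    opSandwich (fun S => wordTensor k (finFunctionFinEquiv.symm S))
        (superSite (stripCellEnum c W) (toSpin (hubbardOpenBoxTT' c W t t' U))) M =
      -(t : ℂ) • (∑ f : Fin c ×ₗ Fin W, ∑ f' : Fin c ×ₗ Fin W, ∑ σ : Fin 2,
          if (rectBoxGraph c W).Adj f f' then
            iterSweep (c * W) k (fun r => jwWordFamily f f' (siteCreation σ) (siteAnnihilation σ)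
              ((cellSiteIndex c W).symm r)) M
          else 0) +
      (U : ℂ) • (∑ f : Fin c ×ₗ Fin W,
          iterSweep (c * W) k (fun r => Function.update (fun _ => (1 : Matrix (Fin 4) (Fin 4) ℂ)) f
            siteDouble ((cellSiteIndex c W).symm r)) M) +
      -(t' : ℂ) • (∑ f : Fin c ×ₗ Fin W, ∑ f' : Fin c ×ₗ Fin W, ∑ σ : Fin 2,
          if (rectBoxDiagGraph c W).Adj f f' then
            iterSweep (c * W) k (fun r => jwWordFamily f f' (siteCreation σ) (siteAnnihilation σ)
              ((cellSiteIndex c W).symm r)) M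
          else 0) := by
  rw [toSpin_hubbardOpenBoxTT'_eq_add_diag, map_add, opSandwich_add, opSandwich_cellTensor_toSpin_cell,
    map_smul, opSandwich_smul, map_sum, opSandwich_sum]
  refine congrArg₂ (fun X Y : Matrix β β ℂ => X + -(t' : ℂ) • Y) rfl ?_
  refine Finset.sum_congr rfl fun f _ => ?_
  rw [map_sum, opSandwich_sum]
  refine Finset.sum_congr rfl fun f' _ => ?_
  rw [map_sum, opSandwich_sum]
  refine Finset.sum_congr rfl fun σ _ => ?_
  by_cases h : (rectBoxDiagGraph c W).Adj f f'
  · rw [if_pos h, if_pos h, onSite_mul_jwString_mul_jwString_mul_onSite h.ne]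
    exact opSandwich_stripCellEnum_productOp k _ M
  · rw [if_neg h, if_neg h, map_zero, opSandwich_zero]

/-- **The diagonal inter-cell part: double sweeps over adjacent row pairs.** The tree's bond image of
`interCellDiagMatrix κ₀ hc t'` for the site-by-site cell tensor is `−t′ Σ_{(y₀,y₁) adjacent, σ}` of
(right half-word sweeps at row `y₁` of (left half-word sweeps at row `y₀` of `1`)), both orientations. -/
theorem bondImage_cellTensor_interCellDiagMatrix {D : ℕ}
    (k : Fin (c * W) → Fin 4 → Matrix (Fin D) (Fin D) ℂ) (hc : 0 < c) (t' : ℝ) :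
    bondImage (fun S => wordTensor k (finFunctionFinEquiv.symm S))
        (interCellDiagMatrix (stripCellEnum c W) hc t') =
      -(t' : ℂ) • ∑ d ∈ adjRowPairs W, ∑ σ : Fin 2,
        (iterSweep (c * W) k
            (fun r => interRightFamily hc d.2 (siteAnnihilation σ) ((cellSiteIndex c W).symm r))
            (iterSweep (c * W) k
              (fun r => interLeftFamily hc d.1 (siteCreation σ * siteParity) ((cellSiteIndex c W).symm r)) 1) +
          iterSweep (c * W) k
            (fun r => interRightFamily hc d.2 (siteCreation σ) ((cellSiteIndex c W).symm r))
            (iterSweep (c * W) k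
              (fun r => interLeftFamily hc d.1 (siteParity * siteAnnihilation σ) ((cellSiteIndex c W).symm r))
              1)) := by
  rw [interCellDiagMatrix, bondImage_smul, bondImage_sum]
  refine congrArg (fun X => -(t' : ℂ) • X) ?_
  refine Finset.sum_congr rfl fun d _ => ?_
  rw [bondImage_sum]
  refine Finset.sum_congr rfl fun σ _ => ?_
  rw [bondImage_add, bondImage_stripCellEnum_kronecker, bondImage_stripCellEnum_kronecker]

/-- **Assembly with `t' ≠ 0`: the tree's bond image of the `t–t′` strip-cell bond matrix is the
verifier's sweep program** — (`c·W` plain sweeps of the `t–t′` intra-cell sweep sum at `M = 1`) +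
(nearest-neighbour inter-cell double sweeps) + (diagonal inter-cell double sweeps). -/
theorem bondImage_cellTensor_stripCellBondMatrixTT' {D : ℕ}
    (k : Fin (c * W) → Fin 4 → Matrix (Fin D) (Fin D) ℂ) (hc : 0 < c) (t t' U : ℝ) :
    bondImage (fun S => wordTensor k (finFunctionFinEquiv.symm S))
        (stripCellBondMatrixTT' (stripCellEnum c W) hc t t' U) =
      iterSweep (c * W) k (fun _ => 1)
        (-(t : ℂ) • (∑ f : Fin c ×ₗ Fin W, ∑ f' : Fin c ×ₗ Fin W, ∑ σ : Fin 2,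
            if (rectBoxGraph c W).Adj f f' then
              iterSweep (c * W) k (fun r => jwWordFamily f f' (siteCreation σ) (siteAnnihilation σ)
                ((cellSiteIndex c W).symm r)) 1
            else 0) +
          (U : ℂ) • (∑ f : Fin c ×ₗ Fin W,
            iterSweep (c * W) k (fun r => Function.update (fun _ => (1 : Matrix (Fin 4) (Fin 4) ℂ)) f
              siteDouble ((cellSiteIndex c W).symm r)) 1) +
          -(t' : ℂ) • (∑ f : Fin c ×ₗ Fin W, ∑ f' : Fin c ×ₗ Fin W, ∑ σ : Fin 2,
            if (rectBoxDiagGraph c W).Adj f f' then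
              iterSweep (c * W) k (fun r => jwWordFamily f f' (siteCreation σ) (siteAnnihilation σ)
                ((cellSiteIndex c W).symm r)) 1
            else 0)) +
      -(t : ℂ) • (∑ y₀ : Fin W, ∑ σ : Fin 2,
        (iterSweep (c * W) k
            (fun r => interRightFamily hc y₀ (siteAnnihilation σ) ((cellSiteIndex c W).symm r))
            (iterSweep (c * W) k
              (fun r => interLeftFamily hc y₀ (siteCreation σ * siteParity) ((cellSiteIndex c W).symm r)) 1) +
          iterSweep (c * W) k
            (fun r => interRightFamily hc y₀ (siteCreation σ) ((cellSiteIndex c W).symm r))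
            (iterSweep (c * W) k
              (fun r => interLeftFamily hc y₀ (siteParity * siteAnnihilation σ) ((cellSiteIndex c W).symm r))
              1))) +
      -(t' : ℂ) • ∑ d ∈ adjRowPairs W, ∑ σ : Fin 2,
        (iterSweep (c * W) k
            (fun r => interRightFamily hc d.2 (siteAnnihilation σ) ((cellSiteIndex c W).symm r))
            (iterSweep (c * W) k
              (fun r => interLeftFamily hc d.1 (siteCreation σ * siteParity) ((cellSiteIndex c W).symm r)) 1) +
          iterSweep (c * W) k
            (fun r => interRightFamily hc d.2 (siteCreation σ) ((cellSiteIndex c W).symm r))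
            (iterSweep (c * W) k
              (fun r => interLeftFamily hc d.1 (siteParity * siteAnnihilation σ) ((cellSiteIndex c W).symm r))
              1)) := by
  rw [stripCellBondMatrixTT', bondImage_add, bondImage_add, bondImage_kronecker_one,
    opSandwich_cellTensor_toSpin_cellTT', heisenberg_stripCellEnum, bondImage_cellTensor_interCellMatrix,
    bondImage_cellTensor_interCellDiagMatrix]

end Summit.Ventures.CertifiedManyBodySolver.Theorems
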